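import Summits.BirchSwinnertonDyer.BirchSwinnertonDyer.Theorems.SylvesterTwoHeegnerIndexCMHalfDecompositionAtThree
import Summits.BirchSwinnertonDyer.BirchSwinnertonDyer.Theorems.SylvesterTwoHeegnerIndexCMHalfTransversal
import Summits.BirchSwinnertonDyer.BirchSwinnertonDyer.Theorems.SylvesterTwoHeegnerIndexLevelFixingKroneckerFrobenius
import Summits.BirchSwinnertonDyer.BirchSwinnertonDyer.Theorems.SylvesterTwoHeegnerIndexLevelFixingClassRestriction
import Summits.BirchSwinnertonDyer.BirchSwinnertonDyer.Theorems.SylvesterTwoHeegnerIndexLevelFixingEtaStarIdealClass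
import HarnessLib

/-!
# ★★ (W2-b), THE CM STATEMENT AT EVERY LEVEL: an automorphism of `ℂ` extending the decomposition involution at `w ∣ 3` of
# `K[9pn]/K` translates the singular moduli of discriminant `−243p²n²` by the ambiguous class `η* = [(243, 243pn, 61p²n²)]`
# (crux `UpperOffV0HSYPlus`, stmt-BirchSwinnertonDyer-19804; route `SylvesterTwoHeegnerIndex`, rung K7t; route (4.2))

Cell `bsd-cm`, seat `bsd-cm-k7t-c2` g33 ((W2-b) seat of record; planner D826 (3) «(4.2) = the level-`n` reduction»; PLAN Ω′,
STATUS 2026-08-29T23:36Z; signature announced 2026-08-30 (D835 (3))).  Helper toward `stmt-BirchSwinnertonDyer-19804`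
(`--supports … --as helper`).  THEOREMS ONLY (no definition, no named fact, no instance, no `sorry`).

THE STATEMENT.  `K ∋ ω` (`ω² + ω + 1 = 0`, `[K:ℚ] = 2`), `p ≡ 1 (3)` prime, `n ≥ 1` with `3 ∤ n`, `v ∋ 3` the place of `K` above
`3`, `L = K[9pn] ⊂ ℂ`, `e : L → K̄` over `K`, and `φ ∈ Gal(L/K)` a NON-TRIVIAL INVOLUTION that is the restriction along `e` of some
`τ ∈ Γ_{K_v}` (the binders of `stub_levelFixingSeven` verbatim).  Then for every `σ ∈ Aut(ℂ)` extending `φ` and every class `κ`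
of discriminant `Δ.D = −243p²n²`:  **`σ(j(κ)) = j(η* · κ)`**, `η* = [(243, 243pn, 61(pn)²)]`.

THE PROOF (class-field-theory free except for the tree's PROVED Artin isomorphism of the ring class field and Chebotarev).
(1) `Φ : Gal(L/K) ≃* Cl(Δ)` with the translation law (k7t-c2 (I) `exists_galClassEquiv_ringClassField`) reduces the claim to
`Φ φ = η*`.  (2) Put `ψ := Φ⁻¹ η*`; `ψ² = 1` (`η*² = 1`, w2b g0 `classOf'_etaStar_mul_self`).  (3) ONE Chebotarev prime for `ψ`
with its Kronecker reading ((II) `exists_frobenius_prime_galClass_eq_or_eq_inv`): a degree-one `u₂ ∤ 9pn`, an absolute Frobenius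
`F₂` at `𝔓₂ ∣ u₂` inducing `ψ`, and the prime form `q₂` of `𝔭_{u₂}` with `Φ ψ = [q₂]^{±1}`, whence `[q₂] = η*` (`η*` is
2-torsion).  (4) At the modulus `m = pn`: `primeClass m u₂ = [𝔄_{η*}]_m = primeClass m w` ((III-a)
`primeClass_eq_idealClass_of_classOf'_eq`, Cox 7.22 at a divisor of the conductor; (III-b) `idealClass_etaStar_eq_primeClass`,
`𝔄_{η*} = (9)𝔭_w`).  (5) DECOMPOSITION (S10a's argument with the Frobenius exposed): `res τ ∈ D_𝔚 ⊆ closure⟨I_𝔚, F⟩` for a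
Frobenius `F` at the prime `𝔚 ∣ w` cut out by `K̄ → K̄_v`; inertia acts trivially on `K[m]`, so the restriction `ρφ` of `φ` to
`K[m]` lies in `⟨F|_{K[m]}⟩ = {1, F|}` and is `≠ 1` (`#ker ρ = 9`, `JZero.finrank_ringClassField_nine_mul`): `ρφ = F|_{K[m]}`.
(6) The level-`m` Artin isomorphism on `e(K[m]) = R_m` (`exists_artinEquiv_abs`, `fieldRange_emb_ringClassField_eq`) sends
`F|` to `primeClass m w` and `F₂|` to `primeClass m u₂`; by (4) they agree, so `ρφ = ρψ`.  (7) `φψ⁻¹ ∈ ker ρ` has order dividing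
`gcd(2, 9) = 1` (`Gal(L/K)` is abelian): `φ = ψ`, `Φ φ = η*`.

USE.  w2b g0's `levelFixing_of_levelTransport_orbit` (p751443) + `orbitForm_classIdentity_sylvesterTower` + the (G2) translation
law + the Bezout engine turn this into `stub_levelFixingSeven` on every class of `p mod 27` and every `n`, from (G3) alone.

HONEST LABEL: no stub closed by this file alone; nothing asserted on 19804; X12.CMAtTwo NOT proved; BSD is proved for no curve.

## References
* Y. Hu, J. Shu, H. Yin, Trans. AMS 372 (2019) = arXiv:1708.05266, §2.2 Prop. 2.4, Thm 2.2–2.3, §4.1. [HuShuYin2019]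
* D. A. Cox, *Primes of the form x² + ny²*, 2nd ed. (2013), §7.C Prop. 7.22, §9.A, §11.D (11.30)–(11.33), Cor. 11.37. [Cox2013]
* J. Neukirch, *Algebraic Number Theory* (1999), Ch. I §9, Ch. VI §7 (7.1), Ch. VII §13 (13.4). [NeukirchANT1999]
* B. H. Gross, *Kolyvagin's work on modular elliptic curves*, LMS LNS 153 (1991), §3. [GrossLMS1991]
-/

set_option autoImplicit false
-- the Summit-side namespace `Summit.BirchSwinnertonDyer.BirchSwinnertonDyer.…` (summit = problem) is mandated by D-0017
set_option linter.dupNamespace false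

noncomputable section

open scoped Classical Pointwise QuadraticAlgebra

namespace Summit.BirchSwinnertonDyer.BirchSwinnertonDyer.Theorems.SylvesterTwoLevelFixingDecomp

open Field NumberField IsDedekindDomain IsDedekindDomain.HeightOneSpectrum Module
  Literature.NumberTheory.EllipticCurves Literature.NumberTheory.GaloisRepresentations
  Literature.NumberTheory.EllipticCurves.HuShuYin2019 Literature.NumberTheory.EllipticCurves.RingClassField
  Literature.NumberTheory.NumberFields Literature.NumberTheory.NumberFields.RingClassField
  Literature.NumberTheory.QuadraticFields.Quadratic Literature.NumberTheory.QuadraticFields.RingClass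
  Literature.Computability.Cryptography.Hallgren2005 Literature.Computability.Cryptography.Hallgren2005.OrderCl
  Literature.NumberTheory.ComplexMultiplication.CMTypeLattice
  Summit.BirchSwinnertonDyer.BirchSwinnertonDyer.Theorems.SylvesterTwoCMHalf
  Summit.BirchSwinnertonDyer.BirchSwinnertonDyer.Theorems.SylvesterTwoLevelFixingEta
  Summit.BirchSwinnertonDyer.BirchSwinnertonDyer.Theorems.SylvesterTwoLevelFixingKronecker
  Summit.BirchSwinnertonDyer.BirchSwinnertonDyer.Theorems.SylvesterTwoLevelFixingRestrict
  Summit.BirchSwinnertonDyer.BirchSwinnertonDyer.Theorems.SylvesterTwoLevelFixingEtaStar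
  Summit.BirchSwinnertonDyer.BirchSwinnertonDyer.Theorems.SylvesterTwoLevelFixingClassA
  Summit.BirchSwinnertonDyer.Rank1Residual.X11b Summit.BirchSwinnertonDyer.Rank1Residual.X11b.RingClassTower

variable {K : Type} [Field K] [NumberField K]

/-- An element of square `1` in a subgroup of order `9` is trivial. [folklore] -/
theorem eq_one_of_sq_eq_one_of_mem_of_card_nine {G : Type*} [Group G] {H : Subgroup G} (hH : Nat.card H = 9)
    {x : G} (hx : x ∈ H) (hx2 : x * x = 1) : x = 1 := by
  have h1 : orderOf x ∣ 9 := by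
    rw [← hH, ← Subgroup.orderOf_mk x hx]
    exact orderOf_dvd_natCard (⟨x, hx⟩ : H)
  have h2 : orderOf x ∣ 2 := orderOf_dvd_of_pow_eq_one (by rw [pow_two]; exact hx2)
  have h : orderOf x ∣ Nat.gcd 9 2 := Nat.dvd_gcd h1 h2
  rw [show Nat.gcd 9 2 = 1 by norm_num, Nat.dvd_one] at h
  exact orderOf_eq_one_iff.mp h

set_option maxHeartbeats 1600000 in
/-- ★★ **(W2-b), THE CM STATEMENT AT EVERY LEVEL.**  `K ∋ ω` (`ω² + ω + 1 = 0`, `[K:ℚ] = 2`), `ι : K → ℂ`, `p ≡ 1 (mod 3)` prime,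
`n ≠ 0`, `3 ∤ n`, `v ∋ 3`, `e : K[9pn] → K̄` a `K`-embedding, `τ ∈ Γ_{K_v}` and `φ ∈ Gal(K[9pn]/K)` with
`res τ ∘ e = e ∘ φ`, `φ² = 1`, `φ ≠ 1`.  Then every `σ ∈ Aut(ℂ)` extending `φ` satisfies `σ(j(κ)) = j(η*·κ)` for every class `κ` of
discriminant `Δ.D = (9pn)²·(−3)`, where `η* = [(243, 243pn, 61p²n²)]`.  Proof: module docstring, steps (1)–(7).
[cite: HuShuYin2019, §2.2 Prop. 2.4 and Thm 2.2–2.3] [cite: Cox2013, §7.C Prop. 7.22, §9.A, §11.D Cor. 11.37]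
[cite: NeukirchANT1999, Ch. VI §7 Thm. (7.1), Ch. VII §13 Thm. (13.4)] [cite: GrossLMS1991, §3] -/
theorem ringEquiv_apply_classJ_of_decompositionInvolution {ζ : K} (hζK : ζ ^ 2 + ζ + 1 = 0) (h2 : finrank ℚ K = 2)
    (ι : K →+* ℂ) {p : ℕ} (hp : p.Prime) (hp3 : p % 3 = 1) {n : ℕ} (hn : n ≠ 0) (hn3 : ¬ 3 ∣ n)
    (v : HeightOneSpectrum (𝓞 K)) (hv : ((3 : ℕ) : 𝓞 K) ∈ v.asIdeal)
    (e : ringClassField K ι (9 * p * n) →+* AlgebraicClosure K)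
    (he : ∀ k : K, e (algebraMap K (ringClassField K ι (9 * p * n)) k) = algebraMap K (AlgebraicClosure K) k)
    (τ : absoluteGaloisGroup (v.adicCompletion K))
    (φ : ringClassField K ι (9 * p * n) ≃ₐ[K] ringClassField K ι (9 * p * n))
    (hτφ : ∀ x : ringClassField K ι (9 * p * n), (show AlgebraicClosure K ≃ₐ[K] AlgebraicClosure K from
      resGal (K := K) (v.adicCompletion K) τ) (e x) = e (φ x))
    (hφ2 : φ * φ = 1) (hφ1 : φ ≠ 1)
    (Δ : NegDiscr) (hΔ : Δ.D = ((9 * p * n : ℕ) : ℤ) ^ 2 * (-3))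
    {σ : ℂ ≃+* ℂ} (hσ : ∀ x : ringClassField K ι (9 * p * n), σ x = ((φ x : ringClassField K ι (9 * p * n)) : ℂ))
    (κ : ClassGroup (QO Δ)) :
    σ (classJ Δ κ) = classJ Δ (classOf' Δ ⟨243, 243 * ((p * n : ℕ) : ℤ), 61 * ((p * n : ℕ) : ℤ) ^ 2⟩ * κ) := by
  -- ### §0 numerology and instances
  have hK := JZero.isImaginaryQuadratic_of_sq_add_self_add_one hζK h2
  have hdK : NumberField.discr K = -3 := JZero.discr_eq_neg_three_of_sq_add_self_add_one hζK h2
  have hp0 : p ≠ 0 := hp.ne_zero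
  have hm0 : p * n ≠ 0 := mul_ne_zero hp0 hn
  have hm3 : ¬ 3 ∣ p * n := by
    intro h
    rcases (Nat.Prime.dvd_mul Nat.prime_three).mp h with h3 | h3
    · have := Nat.mod_eq_zero_of_dvd h3; omega
    · exact hn3 h3
  have hm2 : 2 ≤ p * n := by
    have := hp.two_le; have : 1 ≤ n := Nat.one_le_iff_ne_zero.mpr hn; nlinarith
  have h9m : 9 * p * n = 9 * (p * n) := by ring
  have h9m0 : 9 * p * n ≠ 0 := by rw [h9m]; exact mul_ne_zero (by norm_num) hm0
  haveI := (finiteDimensional_and_isGalois_ringClassField hK ι h9m0).1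
  haveI := (finiteDimensional_and_isGalois_ringClassField hK ι h9m0).2
  haveI := (finiteDimensional_and_isGalois_ringClassField hK ι hm0).1
  haveI := (finiteDimensional_and_isGalois_ringClassField hK ι hm0).2
  -- ### §1 Hasse's `Φ`; reduction to `Φ φ = η*`
  have hΔK : Δ.D = ((9 * p * n : ℕ) : ℤ) ^ 2 * NumberField.discr K := by rw [hΔ, hdK]
  obtain ⟨Φ, hΦ⟩ := exists_galClassEquiv_ringClassField hK ι h9m0 Δ hΔK
  rw [ringEquiv_apply_classJ_of_extends hK ι Δ hΔK hΦ φ hσ κ]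
  have hΔ' : Δ.D = ((9 * (p * n) : ℕ) : ℤ) ^ 2 * (-3) := by rw [hΔ, h9m]
  set ηs : ClassGroup (QO Δ) := classOf' Δ ⟨243, 243 * ((p * n : ℕ) : ℤ), 61 * ((p * n : ℕ) : ℤ) ^ 2⟩ with hηs
  suffices hgoal : Φ φ = ηs by rw [hgoal]
  -- ### §2 `ψ := Φ⁻¹ η*`, an involution
  have hη2 : ηs * ηs = 1 := classOf'_etaStar_mul_self Δ hm3 hΔ'
  set ψ := Φ.symm ηs with hψ
  have hΦψ : Φ ψ = ηs := Φ.apply_symm_apply ηs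
  have hψ2 : ψ * ψ = 1 := Φ.injective (by rw [map_mul, hΦψ, map_one, hη2])
  have hcomm : ∀ a a' : ringClassField K ι (9 * p * n) ≃ₐ[K] ringClassField K ι (9 * p * n), Commute a a' :=
    fun a a' ↦ by apply Φ.injective; rw [map_mul, map_mul, mul_comm]
  -- ### §3 ring-class-order data `(b, hω₀, hD, hs, ιD)` for the conductor `9pn`
  obtain ⟨b, hb⟩ := exists_basis_zero_eq_one h2
  have hω₀ := basis_one_mul_self_eq b hb
  set t₀ : ℤ := b.repr (b 1 * b 1) 1 with ht₀
  set m₀ : ℤ := b.repr (b 1 * b 1) 0 with hm₀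
  have hdisc : t₀ ^ 2 + 4 * m₀ = -3 := by
    have h := discr_eq_sq_add_four_mul b hb; rw [hdK] at h; exact h.symm
  have hD : Δ.D = ((9 * p * n : ℕ) : ℤ) ^ 2 * (t₀ ^ 2 + 4 * m₀) := by rw [hdisc]; exact hΔ
  obtain ⟨s, hs⟩ : ∃ s : ℤ, 2 * s = Δ.D - ((9 * p * n : ℕ) : ℤ) * t₀ := by
    have hT := SylvesterTwoLevelFixingEtaStar.two_mul_ediv_add hdisc
    rw [hΔ]
    rcases Int.even_or_odd ((9 * p * n : ℕ) : ℤ) with ⟨j, hj⟩ | ⟨j, hj⟩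
    · exact ⟨j * (-3 * ((9 * p * n : ℕ) : ℤ) - t₀), by linear_combination (3 * ((9 * p * n : ℕ) : ℤ) + t₀) * hj⟩
    · exact ⟨-((9 * p * n : ℕ) : ℤ) * (3 * j + (t₀ + 27) / 2 - 12), by
        linear_combination 3 * ((9 * p * n : ℕ) : ℤ) * hj - ((9 * p * n : ℕ) : ℤ) * hT⟩
  obtain ⟨ιD, hιD⟩ := Literature.NumberTheory.QuadraticFields.RingClass.exists_ringHom b hω₀ hD hs
  -- ### §4 ONE Chebotarev prime for `ψ` and its Kronecker reading: `[q₂] = η*`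
  obtain ⟨u₂, -, hprime₂, hcu₂, ⟨𝔓₂, h𝔓₂, F₂, hF₂, hF₂e⟩, q₂, hq₂, -, hq₂cop, hq₂map, hdich⟩ :=
    exists_frobenius_prime_galClass_eq_or_eq_inv hK ι h9m0 Δ hΔK b hb hω₀ hD hs ιD hιD Φ hΦ e he ψ Set.finite_empty
  have hq₂cl : classOf' Δ q₂ = ηs := by
    rcases hdich with h | h
    · rw [← h, hΦψ]
    · rw [hΦψ] at h
      rw [← inv_inv (classOf' Δ q₂), ← h]
      exact inv_eq_of_mul_eq_one_right hη2
  -- ### §5 the modulus `m = pn`: `primeClass m u₂ = primeClass m v`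
  have hfd : ((9 * p * n : ℕ) : 𝓞 K) ∈ Ideal.span {((p * n : ℕ) : 𝓞 K)} :=
    Ideal.mem_span_singleton.mpr ⟨9, by push_cast; ring⟩
  have hq₂a' : IsCoprime q₂.a ((p * n : ℕ) : ℤ) := by
    have h : IsCoprime q₂.a ((9 : ℤ) * ((p * n : ℕ) : ℤ)) := by
      have e1 : ((9 * p * n : ℕ) : ℤ) = 9 * ((p * n : ℕ) : ℤ) := by push_cast; ring
      rw [← e1]; exact hq₂cop
    exact h.of_mul_right_right
  have hηpp := isPosPrim_etaStar Δ hm3 hΔ'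
  have hηa : IsCoprime (⟨243, 243 * ((p * n : ℕ) : ℤ), 61 * ((p * n : ℕ) : ℤ) ^ 2⟩ : BinQF).a ((p * n : ℕ) : ℤ) := by
    show IsCoprime (243 : ℤ) ((p * n : ℕ) : ℤ)
    rw [show (243 : ℤ) = 3 ^ 5 by norm_num]
    refine IsCoprime.pow_left ?_
    rw [Prime.coprime_iff_not_dvd Int.prime_three]; exact_mod_cast hm3
  have hpc := primeClass_eq_idealClass_of_classOf'_eq b hb ιD hιD hfd h9m0 hq₂ hq₂a' hq₂map hηpp hηa hq₂cl
  have hηcl := idealClass_etaStar_eq_primeClass b hb hω₀ hdisc h9m hm3 Δ hD hs ιD hιD hζK h2 v hv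
    (map_fIdeal_ne_bot ιD hηpp) (map_fIdeal_sup_eq_top ιD hηa)
  have hpcw : primeClass (p * n) u₂ = primeClass (p * n) v := hpc.trans hηcl
  -- ### §6 restriction maps `r` (level `9pn`) and `r₁` (level `pn`), and the restriction `ρ`
  have hle : ringClassField K ι (p * n) ≤ ringClassField K ι (9 * p * n) :=
    ringClassField_mono hK ι (Dvd.intro_left 9 h9m.symm) h9m0
  set e' : ringClassField K ι (p * n) →+* AlgebraicClosure K := e.comp (RingClassField.inclusion ι hle) with he'def
  have he' : ∀ k : K, e' (algebraMap K (ringClassField K ι (p * n)) k) = algebraMap K (AlgebraicClosure K) k := by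
    intro k
    show e (RingClassField.inclusion ι hle (algebraMap K (ringClassField K ι (p * n)) k)) = _
    rw [(RingClassField.inclusion ι hle).commutes, he]
  have hcoh : ∀ x, e' x = e (RingClassField.inclusion ι hle x) := fun _ ↦ rfl
  obtain ⟨r, hr, hrsurj, -⟩ := exists_restrictHom hK ι h9m0 e he
  obtain ⟨r₁, hr₁, hr₁surj, hr₁ker⟩ := exists_restrictHom hK ι hm0 e' he'
  have hker : r.ker ≤ r₁.ker := by
    intro g hg
    rw [MonoidHom.mem_ker] at hg ⊢
    refine AlgEquiv.ext fun y ↦ e'.injective ?_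
    rw [← hr₁, AlgEquiv.one_apply, hcoh, hr, hg, AlgEquiv.one_apply]
  set ρ := r.liftOfSurjective hrsurj ⟨r₁, hker⟩ with hρdef
  have hρ : ∀ g, ρ (r g) = r₁ g := fun g ↦ r.liftOfRightInverse_comp_apply _ _ ⟨r₁, hker⟩ g
  have hρsurj : Function.Surjective ρ := fun s₁ ↦ by
    obtain ⟨g, rfl⟩ := hr₁surj s₁
    exact ⟨r g, hρ g⟩
  have hcard9 : Nat.card (ringClassField K ι (9 * p * n) ≃ₐ[K] ringClassField K ι (9 * p * n)) =
      9 * Nat.card (ringClassField K ι (p * n) ≃ₐ[K] ringClassField K ι (p * n)) := by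
    rw [IsGalois.card_aut_eq_finrank, IsGalois.card_aut_eq_finrank]
    have h := JZero.finrank_ringClassField_nine_mul hζK h2 ι hm3 hm2
    rw [← h9m] at h
    exact h
  have hkerρ : Nat.card ρ.ker = 9 := by
    have h1 := Subgroup.card_mul_index ρ.ker
    rw [Subgroup.index_ker, MonoidHom.range_eq_top.mpr hρsurj, Subgroup.card_top, hcard9] at h1
    have hpos : 0 < Nat.card (ringClassField K ι (p * n) ≃ₐ[K] ringClassField K ι (p * n)) := Nat.card_pos
    exact Nat.eq_of_mul_eq_mul_right hpos h1
  -- `φ = r (res τ)` and `ψ = r F₂`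
  have hφr : φ = r (resGal (K := K) (v.adicCompletion K) τ) :=
    AlgEquiv.ext fun x ↦ e.injective (by rw [← hr, hτφ])
  have hψr : ψ = r F₂ := AlgEquiv.ext fun x ↦ e.injective (by
    rw [← hr, ← hF₂e x, absoluteGaloisGroup.smul_def]; rfl)
  -- ### §7 decomposition at `w`: `ρ φ = r₁ F` for a Frobenius `F` at the prime `𝔚` cut out by `K̄ → K̄_v`
  obtain ⟨𝔐, h𝔐⟩ := v.localPrimesAbove_nonempty
  have h𝔚 := v.primeBelow_mem_primesAbove (ι := closureEmb (K := K) (v.adicCompletion K)) h𝔐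
  obtain ⟨F, hF⟩ := HeightOneSpectrum.exists_isArithFrobAt_of_mem_primesAbove_holds (v := v) h𝔚
  have hmemP : ρ φ ∈ Subgroup.zpowers (r₁ F) := by
    set S : Subgroup (absoluteGaloisGroup K) := ((Subgroup.zpowers (r₁ F)).comap ρ).comap r with hSdef
    have hSmem : ∀ g : absoluteGaloisGroup K, g ∈ S ↔ r₁ g ∈ Subgroup.zpowers (r₁ F) := fun g ↦ by
      rw [hSdef, Subgroup.mem_comap, Subgroup.mem_comap, hρ]
    have hkerS : r₁.ker ≤ S := fun g hg ↦ by
      rw [hSmem, MonoidHom.mem_ker.mp hg]; exact Subgroup.one_mem _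
    have hSopen : IsOpen (S : Set (absoluteGaloisGroup K)) := Subgroup.isOpen_mono hkerS hr₁ker
    have hSclosed : IsClosed (S : Set (absoluteGaloisGroup K)) := Subgroup.isClosed_of_isOpen S hSopen
    obtain ⟨N₁, hN₁⟩ := exists_subgroup_mem_iff e' he'
    have hunr : Algebra.IsUnramifiedIn (𝓞 (ringClassField K ι (p * n))) v.asIdeal :=
      isUnramifiedIn_ringClassField hK ι hm0 (JZero.not_span_natCast_le_of_not_three_dvd v hv hm3)
    have hI : ∀ i ∈ (v.primeBelow (closureEmb (K := K) (v.adicCompletion K)) 𝔐).inertia (absoluteGaloisGroup K),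
        i ∈ (S : Set (absoluteGaloisGroup K)) := by
      intro i hi
      have hiN : i ∈ N₁ := mem_of_mem_inertia_of_isUnramifiedIn e' he' N₁ hN₁ v hunr h𝔚 hi
      have hi1 : r₁ i = 1 := by
        refine AlgEquiv.ext fun y ↦ e'.injective ?_
        rw [← hr₁, AlgEquiv.one_apply]
        exact (hN₁ i).mp hiN y
      show i ∈ S
      rw [hSmem, hi1]; exact Subgroup.one_mem _
    have hFS : F ∈ (S : Set (absoluteGaloisGroup K)) := by
      show F ∈ S
      rw [hSmem]; exact Subgroup.mem_zpowers _
    have hDS := decompositionSubgroup_subset_of_isClosed_of_frobenius_mem h𝔚 hF hSclosed S.one_mem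
      (fun g hg g' hg' ↦ S.mul_mem hg hg') hI hFS
    have hτD : resGal (K := K) (v.adicCompletion K) τ ∈
        (v.primeBelow (closureEmb (K := K) (v.adicCompletion K)) 𝔐).decompositionSubgroup (absoluteGaloisGroup K) :=
      resGalOfEmb_mem_decompositionSubgroup (closureEmb (K := K) (v.adicCompletion K)) h𝔐 τ
    have hτS : resGal (K := K) (v.adicCompletion K) τ ∈ S := hDS hτD
    rw [hSdef, Subgroup.mem_comap, Subgroup.mem_comap] at hτS
    rw [hφr]; exact hτS
  -- ### §8 the level-`m` Artin isomorphism on `e'(K[m]) = R_m`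
  let φe' : ringClassField K ι (p * n) →ₐ[K] AlgebraicClosure K := AlgHom.mk e' he'
  have hRm := fieldRange_emb_ringClassField_eq hK ι hm0 e' he'
  let R : IntermediateField K (AlgebraicClosure K) := φe'.fieldRange
  have hRdef : R = φe'.fieldRange := rfl
  let eR : ringClassField K ι (p * n) ≃ₐ[K] R := AlgEquiv.ofInjectiveField φe'
  have heR : ∀ x, ((eR x : R) : AlgebraicClosure K) = e' x := fun x ↦
    AlgEquiv.ofInjective_apply φe' φe'.toRingHom.injective x
  haveI : FiniteDimensional K R := by rw [hRdef, hRm]; infer_instance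
  haveI : IsGalois K R := by rw [hRdef, hRm]; infer_instance
  haveI : NumberField R := by rw [hRdef, hRm]; infer_instance
  have hunrR : ∀ v' : HeightOneSpectrum (𝓞 K), ¬ Ideal.span {((p * n : ℕ) : 𝓞 K)} ≤ v'.asIdeal →
      Algebra.IsUnramifiedIn (𝓞 R) v'.asIdeal := by
    rw [hRdef, hRm]; exact fun v' hv' ↦ isUnramifiedIn_classFieldOfIdealGroup_ringClassDen hm0 hv'
  have hsplitR : ∀ v' : HeightOneSpectrum (𝓞 K), ¬ Ideal.span {((p * n : ℕ) : 𝓞 K)} ≤ v'.asIdeal →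
      (v' ∈ splitPrimes K R ↔ primeClass (p * n) v' = 1) := by
    rw [hRdef, hRm]; exact fun v' hv' ↦ mem_splitPrimes_classFieldOfIdealGroup_ringClassDen_iff hm0 hv'
  haveI : Finite (RingClassGroup K (p * n)) := finite_ringClassGroup h2 hm0
  obtain ⟨art, hart⟩ := exists_artinEquiv_abs (p * n) hm0 R hunrR hsplitR
  have hres : ∀ (g : absoluteGaloisGroup K) (y : R),
      ((absRestrictNormalHom R g y : R) : AlgebraicClosure K) = (show AlgebraicClosure K ≃ₐ[K] AlgebraicClosure K from g) y :=
    fun g y ↦ AlgEquiv.restrictNormalHom_apply _ _ y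
  -- `r₁ g` is `absRestrictNormalHom R g` read through `eR`
  have hr₁R : ∀ (g : absoluteGaloisGroup K) (y : ringClassField K ι (p * n)),
      e' (r₁ g y) = ((absRestrictNormalHom R g (eR y) : R) : AlgebraicClosure K) := by
    intro g y; rw [hres, heR, hr₁]
  have hvm : ¬ Ideal.span {((p * n : ℕ) : 𝓞 K)} ≤ v.asIdeal := JZero.not_span_natCast_le_of_not_three_dvd v hv hm3
  have hu₂m : ¬ Ideal.span {((p * n : ℕ) : 𝓞 K)} ≤ u₂.asIdeal := by
    intro h; apply hcu₂
    rw [Ideal.span_singleton_le_iff_mem] at h ⊢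
    have e1 : ((9 * p * n : ℕ) : 𝓞 K) = 9 * ((p * n : ℕ) : 𝓞 K) := by push_cast; ring
    rw [e1]; exact Ideal.mul_mem_left _ _ h
  have hartF : art (absRestrictNormalHom R F) = primeClass (p * n) v := hart v hvm _ h𝔚 F hF
  have hartF₂ : art (absRestrictNormalHom R F₂) = primeClass (p * n) u₂ := hart u₂ hu₂m _ h𝔓₂ F₂ hF₂
  have hFF₂ : absRestrictNormalHom R F = absRestrictNormalHom R F₂ :=
    art.injective (by rw [hartF, hartF₂, hpcw])
  have hr₁FF₂ : r₁ F = r₁ F₂ := by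
    refine AlgEquiv.ext fun y ↦ e'.injective ?_
    rw [hr₁R, hr₁R, hFF₂]
  have heR₁ : ∀ (g : absoluteGaloisGroup K) (y : ringClassField K ι (p * n)),
      eR (r₁ g y) = absRestrictNormalHom R g (eR y) := fun g y ↦ by
    apply Subtype.ext; rw [heR]; exact hr₁R g y
  -- `(r₁ F)² = 1` through the Artin map (`[𝔭_w]² = 1`)
  have hr₁F2 : r₁ F * r₁ F = 1 := by
    have h1 : absRestrictNormalHom R F * absRestrictNormalHom R F = 1 := by
      apply art.injective
      rw [map_mul, map_one, hartF, ← pow_two]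
      exact JZero.primeClass_three_sq hζK h2 v hv (by omega) hm3
    refine AlgEquiv.ext fun y ↦ eR.injective ?_
    rw [AlgEquiv.mul_apply, heR₁, heR₁, ← AlgEquiv.mul_apply, h1, AlgEquiv.one_apply, AlgEquiv.one_apply]
  -- ### §9 `ρ φ = r₁ F = r₁ F₂ = ρ ψ`, hence `φ = ψ`
  have hρφ : ρ φ = r₁ F := by
    rcases eq_one_or_eq_of_mem_zpowers hr₁F2 hmemP with h1 | h1
    · exfalso
      have hφker : φ ∈ ρ.ker := by rw [MonoidHom.mem_ker, h1]
      exact hφ1 (eq_one_of_sq_eq_one_of_mem_of_card_nine hkerρ hφker hφ2)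
    · exact h1
  have hρψ : ρ ψ = r₁ F₂ := by rw [hψr, hρ]
  have hφψ : φ * ψ⁻¹ ∈ ρ.ker := by
    rw [MonoidHom.mem_ker, map_mul, map_inv, hρφ, hρψ, hr₁FF₂, mul_inv_cancel]
  have hsq : φ * ψ⁻¹ * (φ * ψ⁻¹) = 1 := by
    rw [inv_eq_of_mul_eq_one_right hψ2, (hcomm ψ φ).mul_mul_mul_comm, hφ2, hψ2, one_mul]
  have hφeq : φ = ψ := by
    have h := eq_one_of_sq_eq_one_of_mem_of_card_nine hkerρ hφψ hsq
    rwa [mul_inv_eq_one] at h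
  rw [hφeq, hΦψ]

end Summit.BirchSwinnertonDyer.BirchSwinnertonDyer.Theorems.SylvesterTwoLevelFixingDecomp

end
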